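import Summits.AtomisticToContinuum.Crystallization.Theorems.OverbindingBudgetAffineCalmDescent

/-!
# NODE g103 «StableDescent» (lens-4), part A — vocabulary, the pieces, the kernel-certified comparisons

TARGET: the crux of record of the 31280 line (2c) after (413) «CalmDescent», `CalmRigidity` (tree `…AffineCalmDescentA`): every calm
(`(3/50,1/450)`-registered to depth `L`, in-window, TIGHT `nn ≤ 21/20`, `τ`-force-balanced) ball is `η₂`-homogeneous on its `12·nn`-ball.
STABBOX (this generation, desk numerics, `HOME/decomp-a2c-lens-4/g103/num/STABBOX.md`): the `t = 21/20` calm box CONTAINS phonon-unstable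
`(3/50)`-registered HOMOGENEOUS Lennard-Jones equilibria (adversarial `λ_min` on the `3/50` registration shell: fcc `+0.29 @ nn = 1.00`, `+0.04 @ 1.04`,
`−0.17 @ 1.045`, `−0.42 @ 1.05`; hcp `+0.17 @ 1.02`, `+0.01 @ 1.04`, `−0.23 @ 1.05`; threshold `t⋆ ≈ 1.041` for both lattices) — so by generic
bifurcation small-amplitude MODULATED equilibria live inside the box and `CalmRigidity` is booked «presumably false as typed» (critic r1911 (1)); its
elliptic proof route needs `Λ_min > 0` on the whole box and is dead at the literal `21/20`, alive for `t ≤ 26/25`.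

EXTREMAL MOVE (lens «minimal counterexample»): a counterexample to the MID census may be taken not only force-balanced (first order, (413)) but
LOCALLY STABLE (second order) — instability under a localized bounded move is itself a census-priced witness.  Two dials are freed:
* the tightness literal: `t` (record instance `t = 1`; the extra dilated deep sites `nn ∈ (t, 21/20]` are LONG scale-bad at `a = 122/125` as soon as
  `t ≥ (122/125)(51/50) = 0.99552`, so `DilatedDeepT t ⟸ TBDSG(ρ ≤ 64)` exactly as before — no new strength, PROVED `dilatedDeepT_of_tbdsg`);
* the order of the normal form: `LocStable δ κ Ls y j` («no move supported on in-window sites of the `Ls·nn`-ball of `j`, each displacement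
  `≤ δ/4`, lowers `interactionEnergy lennardJones` by more than `κ`»); its in-window `64`-deep failures are paid by the NEW TRUE-type currency
  **`SoftGain`** (paper proof complete, memo §3: a maximal `D`-separated family of unstable sites, their destabilizing moves applied SIMULTANEOUSLY,
  the exact pair-potential second-difference identity for the cross terms, the `r⁻⁸` Lennard-Jones tail over `δ`-separated matter, the FREE floor
  `floor_le` at the moved — still `δ/2`-separated, hence injective — configuration, packing; rebate constant `C = 0`).
The crux becomes **`StableRigidity t`**: a calm ball all of whose sites are tight-`t` AND `κ`-locally-stable is `η₂`-homogeneous (`OptDeepReg 12 η₂`)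
— registered Liouville for LOCAL MINIMISERS, not for all equilibria.  Kernel-certified: `StableRigidity t ⟸ CalmRigidityT t ⟸ CalmRigidity` (any `t`).

GUARD DESIGN.  Calmness at `21/20` ((413) `Calm`) stays the primary excluded middle, so (413)'s packing lemma `exists_witness_of_not_calm` is reused BY
NAME; tightness-`t` and stability enter as a GUARD `G` required on the whole calm ball (`CalmG G`), whose in-window `64`-deep failures are counted by
`guardBadCount G` — for the guard of record `StableGuard t δ κ Ls` they are `DilatedT t` or `LocUnstable` sites (PROVED `guardBadCount_stable_le`).
Part B (`…AffineStableDescent`) carries the census glue, `CoarseMid ⟸ AgitGain ∧ DilatedDeepT t ∧ SoftGain ∧ StableRigidity t ∧ LooseCalm ∧ OpticCalm`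
(`t ≤ 21/20`), the record seams with `CalmRigidity` ABSENT, and the instance `t = 1`.

PIECES (this part; `notDeep₆₄ := notDeepCount 64 (3/50) (1/450)`):
* `SoftGain`          — NEW currency (second order) · TRUE-type · ATTACKABLE-M (memo §3) · census-type `CensusW` exactly as `AgitGain`.
* `DilatedDeepT t`    — scale currency · TRUE-type · below the apex TBDSG for `t ≥ 0.99552` (PROVED) · a LEAF of the cone (TBDSG is the apex, not a leaf).
* `CalmRigidityT t`   — (413)'s crux with the tightness literal `t` (first-order normal form kept for provers who want it; `t ≤ 26/25` is elliptic by STABBOX).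
* `StableRigidity t`  — THE CRUX · energy-free · UNDECIDED · ATTACKABLE-L (compactness + positive second variation ⇒ linear Saint-Venant decay) · why it
                        might fail: a registered tight entire LOCAL MINIMISER of Lennard-Jones that is not a strained internally-relaxed stacking (none known;
                        STABBOX: homogeneous registered states are uniformly stable for `t ≤ 26/25`, the modulated branch lives above `t⋆ ≈ 1.041`).
-/

namespace Summit.AtomisticToContinuum.Crystallization.Theorems.OverbindingBudgetAffineStableDescent

open scoped BigOperators Classical
open Literature.MathematicalPhysics.StatisticalMechanics
open Literature.Geometry.DiscreteGeometry (IsChargeFree nearestDist nearestDist_nonneg nearestDist_le_dist fccTwoShellPattern hcpTwoShellPattern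
  bondGraph)
open Summit.AtomisticToContinuum.Crystallization.Theorems.OverbindingBudgetMisfitCensusStatements (Bad Short Long)
open Summit.AtomisticToContinuum.Crystallization.Theorems.OverbindingBudgetMisfitRegistration (Framed Reg DeepReg regScaleCount)
open Summit.AtomisticToContinuum.Crystallization.Theorems.OverbindingBudgetMisfitWindowStatements (InWindow offCount)
open Summit.AtomisticToContinuum.Crystallization.Theorems.OverbindingBudgetBalancedCensusStatements
open Summit.AtomisticToContinuum.Crystallization.Theorems.OverbindingBudgetAffineLadder
open Summit.AtomisticToContinuum.Crystallization.Theorems.OverbindingBudgetAffineMesoCut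
open Summit.AtomisticToContinuum.Crystallization.Theorems.OverbindingBudgetAffinePhaseCut
open Summit.AtomisticToContinuum.Crystallization.Theorems.OverbindingBudgetAffineCushionCut
open Summit.AtomisticToContinuum.Crystallization.Theorems.OverbindingBudgetAffineTwinCut
open Summit.AtomisticToContinuum.Crystallization.Theorems.OverbindingBudgetAffineRunCut
open Summit.AtomisticToContinuum.Crystallization.Theorems.OverbindingBudgetAffineCompressedCut
open Summit.AtomisticToContinuum.Crystallization.Theorems.OverbindingBudgetAffineRunCutFlat
open Summit.AtomisticToContinuum.Crystallization.Theorems.OverbindingBudgetAffineWildCut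
open Summit.AtomisticToContinuum.Crystallization.Theorems.OverbindingBudgetAffineCoreDescent
open Summit.AtomisticToContinuum.Crystallization.Theorems.OverbindingBudgetAffineStrainBand
open Summit.AtomisticToContinuum.Crystallization.Theorems.OverbindingBudgetAffineCalmDescent

variable {N : ℕ}

/-! ## §1  Guards on the calm ball -/

/-- `BallGuard G L y i`: every site of the `L·nn`-ball of `i` (including `i`) satisfies the guard `G`. -/
def BallGuard (G : ∀ {N : ℕ}, (Fin N → EuclideanSpace ℝ (Fin 3)) → Fin N → Prop) (L : ℝ) (y : Fin N → EuclideanSpace ℝ (Fin 3))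
    (i : Fin N) : Prop :=
  ∀ i' : Fin N, dist (y i') (y i) ≤ L * nearestDist y i → G y i'

/-- `CalmG G δ τ L y i`: calm ((413) `Calm`: registered to depth `L`, in-window, tight `21/20`, `τ`-force-balanced) AND `G`-guarded on the ball. -/
def CalmG (G : ∀ {N : ℕ}, (Fin N → EuclideanSpace ℝ (Fin 3)) → Fin N → Prop) (δ τ L : ℝ) (y : Fin N → EuclideanSpace ℝ (Fin 3))
    (i : Fin N) : Prop :=
  Calm δ τ L y i ∧ BallGuard G L y i

/-- `guardBadCount G δ y := #{j | in-window, 64-deep registered, ¬ G}` — the chargeable failures of the guard. -/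
noncomputable def guardBadCount (G : ∀ {N : ℕ}, (Fin N → EuclideanSpace ℝ (Fin 3)) → Fin N → Prop) (δ : ℝ)
    (y : Fin N → EuclideanSpace ℝ (Fin 3)) : ℕ :=
  Nat.card {j // InWindow δ 2 y j ∧ DeepReg 64 (3 / 50) (1 / 450) y j ∧ ¬ G y j}

/-! ## §2  Second-order vocabulary: local stability under bounded localized moves; dilation past `t` -/

/-- `LocStable δ κ Ls y i`: no move `d` supported on IN-WINDOW sites of the `Ls·nn`-ball of `i`, with every displacement `‖d k‖ ≤ δ/4` (so the moved
in-window sites stay `δ/2`-separated), lowers `interactionEnergy lennardJones` by more than `κ`. -/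
def LocStable (δ κ Ls : ℝ) (y : Fin N → EuclideanSpace ℝ (Fin 3)) (i : Fin N) : Prop :=
  ∀ d : Fin N → EuclideanSpace ℝ (Fin 3),
    (∀ k : Fin N, d k ≠ 0 → dist (y k) (y i) ≤ Ls * nearestDist y i ∧ InWindow δ 2 y k) →
    (∀ k : Fin N, ‖d k‖ ≤ δ / 4) →
    interactionEnergy lennardJones y ≤ interactionEnergy lennardJones (y + d) + κ

/-- `LocUnstable δ κ Ls y j`: `j` is in the window, `64`-deep registered, and NOT `(δ, κ, Ls)`-locally stable. -/
def LocUnstable (δ κ Ls : ℝ) (y : Fin N → EuclideanSpace ℝ (Fin 3)) (j : Fin N) : Prop :=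
  InWindow δ 2 y j ∧ DeepReg 64 (3 / 50) (1 / 450) y j ∧ ¬ LocStable δ κ Ls y j

/-- `#LocUnstable δ κ Ls`. -/
noncomputable def locUnstableCount (δ κ Ls : ℝ) (y : Fin N → EuclideanSpace ℝ (Fin 3)) : ℕ :=
  Nat.card {j // LocUnstable δ κ Ls y j}

/-- `DilatedT δ t y j`: `64`-deep registered, in-window, `nearestDist y j > t` ((413) `Dilated` is `t = 21/20`). -/
def DilatedT (δ t : ℝ) (y : Fin N → EuclideanSpace ℝ (Fin 3)) (j : Fin N) : Prop :=
  DeepReg 64 (3 / 50) (1 / 450) y j ∧ InWindow δ 2 y j ∧ t < nearestDist y j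

/-- `#DilatedT δ t`. -/
noncomputable def dilatedTCount (δ t : ℝ) (y : Fin N → EuclideanSpace ℝ (Fin 3)) : ℕ :=
  Nat.card {j // DilatedT δ t y j}

/-- The tight guard: `nearestDist y j ≤ t`. -/
def TightGuard (t : ℝ) : ∀ {N : ℕ}, (Fin N → EuclideanSpace ℝ (Fin 3)) → Fin N → Prop :=
  fun y j => nearestDist y j ≤ t

/-- The guard of record: tight-`t` AND `(δ, κ, Ls)`-locally stable. -/
def StableGuard (t δ κ Ls : ℝ) : ∀ {N : ℕ}, (Fin N → EuclideanSpace ℝ (Fin 3)) → Fin N → Prop :=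
  fun y j => nearestDist y j ≤ t ∧ LocStable δ κ Ls y j

/-! ## §3  The pieces -/

/-- **`SoftGain`** [route statement · this node · kind: crux-candidate · NEW (second-order currency) · TRUE-type · ATTACKABLE-M — memo §3: maximal
`D(κ, Ls, δ)`-separated family of unstable sites, destabilizing moves applied simultaneously, exact second-difference identity for pair potentials,
`|V″| + |V′|/r ≤ 21 r⁻⁸` tail over `δ`-separated matter, `floor_le` at the moved injective configuration, packing; `C = 0` · census-type: `CensusW`
exactly as `AgitGain` (the move family, `κ` and the payer are explicit in `LocUnstable`) · not implied by `CoarseMid` · why it might fail: only if the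
cross terms between far-apart simultaneous moves were not summable (they are: `r⁻⁸`)]: at every window, every `κ > 0`, `Ls ≥ 0`, the in-window
`64`-deep `(δ, κ, Ls)`-unstable sites pay. -/
def SoftGain : Prop :=
  ∀ δ : ℝ, 0 < δ → δ ≤ 2 → ∀ κ Ls : ℝ, 0 < κ → 0 ≤ Ls →
    CensusW (fun y => locUnstableCount δ κ Ls y) (fun y => notDeepCount 64 (3 / 50) (1 / 450) y) δ 2

/-- **`DilatedDeepT t`** [route statement · this node · kind: support · scale currency · TRUE-type · below the apex TBDSG for `t ≥ (122/125)(51/50)` (PROVED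
`dilatedDeepT_of_tbdsg`; TBDSG is the APEX of line (2), so this is a no-new-strength certificate and `DilatedDeepT` is a LEAF) · why it might fail: only with
TBDSG]: at every window the `64`-deep in-window sites with `nn > t` pay. -/
def DilatedDeepT (t : ℝ) : Prop :=
  ∀ δ : ℝ, 0 < δ → δ ≤ 2 → CensusW (fun y => dilatedTCount δ t y) (fun y => notDeepCount 64 (3 / 50) (1 / 450) y) δ 2

/-- **`CalmRigidityT t`** [route statement · this node · (413)'s `CalmRigidity` with the tightness literal freed: rigidity is asked only of calm balls all of
whose sites have `nn ≤ t` · STABBOX: elliptic (hence ATTACKABLE-L by Saint-Venant) for `t ≤ 26/25`, presumably false for `t ≥ 1.042`]. -/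
def CalmRigidityT (t : ℝ) : Prop :=
  ∀ δ : ℝ, 0 < δ → δ ≤ 2 → ∀ η₂ : ℝ, 0 < η₂ → ∃ τ L : ℝ, 0 < τ ∧ 0 ≤ L ∧
    ∀ (N : ℕ) (y : Fin N → EuclideanSpace ℝ (Fin 3)), Function.Injective y →
      ∀ i : Fin N, CalmG (TightGuard t) δ τ L y i → OptDeepReg 12 η₂ (1 / 10) (1 / 450) y i

/-- **`StableRigidity t`** [route statement · this node · kind: crux · ENERGY-FREE · «registered Liouville for local minimisers» · UNDECIDED · ATTACKABLE-L ·
why it might fail: a `(3/50)`-registered, tight-`t`, force-balanced, locally STABLE entire Lennard-Jones configuration that is not a strained internally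
relaxed stacking]: for every window and precision `η₂ > 0` there are `τ, κ > 0`, `Ls, L ≥ 0` such that every calm site whose `L`-ball is tight-`t` and
`(δ, κ, Ls)`-locally stable is `η₂`-homogeneous on its `12·nn`-ball. -/
def StableRigidity (t : ℝ) : Prop :=
  ∀ δ : ℝ, 0 < δ → δ ≤ 2 → ∀ η₂ : ℝ, 0 < η₂ → ∃ τ κ Ls L : ℝ, 0 < τ ∧ 0 < κ ∧ 0 ≤ Ls ∧ 0 ≤ L ∧
    ∀ (N : ℕ) (y : Fin N → EuclideanSpace ℝ (Fin 3)), Function.Injective y →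
      ∀ i : Fin N, CalmG (StableGuard t δ κ Ls) δ τ L y i → OptDeepReg 12 η₂ (1 / 10) (1 / 450) y i

/-! ## §4  Elementary relations and the kernel-certified comparisons -/

/-- `BallGuard` is antitone in the radius. [this node] -/
theorem ballGuard_anti {G : ∀ {N : ℕ}, (Fin N → EuclideanSpace ℝ (Fin 3)) → Fin N → Prop} {L L' : ℝ} (hL : L ≤ L')
    {y : Fin N → EuclideanSpace ℝ (Fin 3)} {i : Fin N} (h : BallGuard G L' y i) : BallGuard G L y i :=
  fun i' hi' => h i' (hi'.trans (mul_le_mul_of_nonneg_right hL (nearestDist_nonneg y i)))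

/-- `BallGuard` is monotone in the guard. [this node] -/
theorem ballGuard_mono {G G' : ∀ {N : ℕ}, (Fin N → EuclideanSpace ℝ (Fin 3)) → Fin N → Prop}
    (hGG : ∀ {N : ℕ} (y : Fin N → EuclideanSpace ℝ (Fin 3)) (j : Fin N), G y j → G' y j) {L : ℝ}
    {y : Fin N → EuclideanSpace ℝ (Fin 3)} {i : Fin N} (h : BallGuard G L y i) : BallGuard G' L y i :=
  fun i' hi' => hGG y i' (h i' hi')

/-- `CalmG` is antitone in `(τ, L)`. [this node] -/
theorem calmG_anti {G : ∀ {N : ℕ}, (Fin N → EuclideanSpace ℝ (Fin 3)) → Fin N → Prop} {δ τ τ' L L' : ℝ} (hτ : τ' ≤ τ) (hL : L ≤ L')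
    {y : Fin N → EuclideanSpace ℝ (Fin 3)} {i : Fin N} (h : CalmG G δ τ' L' y i) : CalmG G δ τ L y i :=
  ⟨calm_anti hτ hL h.1, ballGuard_anti hL h.2⟩

/-- Ball inclusion: if `i, i'` are in-window and `dist (y i') (y i) ≤ R·nn_i` (`R ≤ L`, `δ > 0`), the `((L−R)δ/2)·nn_{i'}`-ball of `i'` lies in the `L·nn_i`-ball
of `i`. [this node] -/
theorem mem_calmBall_of_near {δ L R : ℝ} (hδ : 0 < δ) (hRL : R ≤ L) {y : Fin N → EuclideanSpace ℝ (Fin 3)} {i i' k : Fin N}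
    (hwi : InWindow δ 2 y i) (hwi' : InWindow δ 2 y i') (hi' : dist (y i') (y i) ≤ R * nearestDist y i)
    (hk : dist (y k) (y i') ≤ (L - R) * δ / 2 * nearestDist y i') : dist (y k) (y i) ≤ L * nearestDist y i := by
  have h1 : (L - R) * δ / 2 * nearestDist y i' ≤ (L - R) * nearestDist y i := by
    have hα : 0 ≤ L - R := by linarith
    have h2 : δ / 2 * nearestDist y i' ≤ nearestDist y i := by
      have h3 := hwi'.2
      have h4 := hwi.1
      nlinarith [hδ.le]
    calc (L - R) * δ / 2 * nearestDist y i' = (L - R) * (δ / 2 * nearestDist y i') := by ring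
      _ ≤ (L - R) * nearestDist y i := mul_le_mul_of_nonneg_left h2 hα
  calc dist (y k) (y i) ≤ dist (y k) (y i') + dist (y i') (y i) := dist_triangle _ _ _
    _ ≤ (L - R) * nearestDist y i + R * nearestDist y i := add_le_add (hk.trans h1) hi'
    _ = L * nearestDist y i := by ring

/-- Guarded calmness is inherited by the sites of the `R·nn`-ball, at depth `(L − R)δ/2` ((413) `calm_of_near` + ball inclusion). [this node] -/
theorem calmG_of_near {G : ∀ {N : ℕ}, (Fin N → EuclideanSpace ℝ (Fin 3)) → Fin N → Prop} {δ τ L R : ℝ} (hδ : 0 < δ) (hR : 0 ≤ R)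
    (hRL : R ≤ L) {y : Fin N → EuclideanSpace ℝ (Fin 3)} {i i' : Fin N} (h : CalmG G δ τ L y i)
    (hi' : dist (y i') (y i) ≤ R * nearestDist y i) : CalmG G δ τ ((L - R) * δ / 2) y i' := by
  have hL : 0 ≤ L := hR.trans hRL
  have hwi : InWindow δ 2 y i := (h.1.2 i (by rw [dist_self]; exact mul_nonneg hL (nearestDist_nonneg y i))).1
  have hwi' : InWindow δ 2 y i' := (h.1.2 i' (hi'.trans (mul_le_mul_of_nonneg_right hRL (nearestDist_nonneg y i)))).1
  exact ⟨calm_of_near hδ hR hRL h.1 hi', fun k hk => h.2 k (mem_calmBall_of_near hδ hRL hwi hwi' hi' hk)⟩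

/-- **`CalmRigidity ⇒ CalmRigidityT t`** (any `t`; in particular `t = 1`: tight-`1` calm balls are tight-`21/20` calm balls). [this node] -/
theorem calmRigidityT_of_calmRigidity (t : ℝ) (h : CalmRigidity) : CalmRigidityT t := by
  intro δ hδ hδ2 η₂ hη
  obtain ⟨τ, L, hτ, hL, hr⟩ := h δ hδ hδ2 η₂ hη
  exact ⟨τ, L, hτ, hL, fun N y hy i hc => hr N y hy i hc.1⟩

/-- **`CalmRigidityT t ⇒ StableRigidity t`** (`κ := 1`, `Ls := 0`: the stable guard implies the tight guard). [this node] -/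
theorem stableRigidity_of_calmRigidityT {t : ℝ} (h : CalmRigidityT t) : StableRigidity t := by
  intro δ hδ hδ2 η₂ hη
  obtain ⟨τ, L, hτ, hL, hr⟩ := h δ hδ hδ2 η₂ hη
  refine ⟨τ, 1, 0, L, hτ, one_pos, le_rfl, hL, fun N y hy i hc => hr N y hy i ⟨hc.1, ?_⟩⟩
  exact ballGuard_mono (G := StableGuard t δ 1 0) (G' := TightGuard t) (fun y j hj => hj.1) hc.2

/-- **`CalmRigidity ⇒ StableRigidity t`.** [this node] -/
theorem stableRigidity_of_calmRigidity (t : ℝ) (h : CalmRigidity) : StableRigidity t :=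
  stableRigidity_of_calmRigidityT (calmRigidityT_of_calmRigidity t h)

/-- `StableRigidity` is ANTITONE in the tightness literal: a smaller `t` asks rigidity of fewer balls. [this node] -/
theorem stableRigidity_anti {t t' : ℝ} (htt : t ≤ t') (h : StableRigidity t') : StableRigidity t := by
  intro δ hδ hδ2 η₂ hη
  obtain ⟨τ, κ, Ls, L, hτ, hκ, hLs, hL, hr⟩ := h δ hδ hδ2 η₂ hη
  refine ⟨τ, κ, Ls, L, hτ, hκ, hLs, hL, fun N y hy i hc => hr N y hy i ⟨hc.1, ?_⟩⟩
  exact ballGuard_mono (G := StableGuard t δ κ Ls) (G' := StableGuard t' δ κ Ls) (fun y j hj => ⟨hj.1.trans htt, hj.2⟩) hc.2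

/-- `CalmRigidityT` is antitone in `t`. [this node] -/
theorem calmRigidityT_anti {t t' : ℝ} (htt : t ≤ t') (h : CalmRigidityT t') : CalmRigidityT t := by
  intro δ hδ hδ2 η₂ hη
  obtain ⟨τ, L, hτ, hL, hr⟩ := h δ hδ hδ2 η₂ hη
  refine ⟨τ, L, hτ, hL, fun N y hy i hc => hr N y hy i ⟨hc.1, ?_⟩⟩
  exact ballGuard_mono (G := TightGuard t) (G' := TightGuard t') (fun y j hj => le_trans hj htt) hc.2

/-- `DilatedDeepT` is MONOTONE in `t`: fewer sites are dilated past a larger `t`. [this node] -/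
theorem dilatedDeepT_mono {t t' : ℝ} (htt : t ≤ t') (h : DilatedDeepT t) : DilatedDeepT t' := fun δ hδ hδ2 => by
  refine censusW_mono (fun y => ?_) (fun _ => le_rfl) (h δ hδ hδ2)
  unfold dilatedTCount
  exact natCard_le_of_imp fun j hj => ⟨hj.1, hj.2.1, lt_of_le_of_lt htt hj.2.2⟩

/-- The guard-bad sites of the stable guard are dilated past `t` or locally unstable. [this node] -/
theorem guardBadCount_stable_le (t δ κ Ls : ℝ) (y : Fin N → EuclideanSpace ℝ (Fin 3)) :
    guardBadCount (StableGuard t δ κ Ls) δ y ≤ dilatedTCount δ t y + locUnstableCount δ κ Ls y := by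
  unfold guardBadCount dilatedTCount locUnstableCount
  exact natCard_le_add_of_imp fun j hj => by
    by_cases hn : nearestDist y j ≤ t
    · exact Or.inr ⟨hj.1, hj.2.1, fun hs => hj.2.2 ⟨hn, hs⟩⟩
    · exact Or.inl ⟨hj.2.1, hj.1, not_le.1 hn⟩

/-- The guard-bad sites of the tight guard are dilated past `t`. [this node] -/
theorem guardBadCount_tight_le (t δ : ℝ) (y : Fin N → EuclideanSpace ℝ (Fin 3)) :
    guardBadCount (TightGuard t) δ y ≤ dilatedTCount δ t y := by
  unfold guardBadCount dilatedTCount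
  exact natCard_le_of_imp fun j hj => ⟨hj.2.1, hj.1, not_le.1 hj.2.2⟩

/-- (413)'s dilated sites (`nn > 21/20`) are dilated past any `t ≤ 21/20`. [this node] -/
theorem dilatedCount_le_dilatedTCount {t : ℝ} (ht : t ≤ 21 / 20) (δ : ℝ) (y : Fin N → EuclideanSpace ℝ (Fin 3)) :
    dilatedCount δ y ≤ dilatedTCount δ t y := by
  unfold dilatedCount dilatedTCount
  exact natCard_le_of_imp fun j hj => ⟨hj.1, hj.2.1, lt_of_le_of_lt ht hj.2.2⟩

/-- `DilatedDeepT t ⇒ DilatedDeep` for `t ≤ 21/20`, and `DilatedDeep ⇒ DilatedDeepT (21/20)`. [this node] -/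
theorem dilatedDeep_of_dilatedDeepT {t : ℝ} (ht : t ≤ 21 / 20) (h : DilatedDeepT t) : DilatedDeep := fun δ hδ hδ2 =>
  censusW_mono (fun y => dilatedCount_le_dilatedTCount ht δ y) (fun _ => le_rfl) (h δ hδ hδ2)

/-- `DilatedDeep ⇒ DilatedDeepT (21/20)` (the converse direction at the record literal). [this node] -/
theorem dilatedDeepT_of_dilatedDeep (h : DilatedDeep) : DilatedDeepT (21 / 20) := fun δ hδ hδ2 => by
  refine censusW_mono (fun y => ?_) (fun _ => le_rfl) (h δ hδ hδ2)
  unfold dilatedCount dilatedTCount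
  exact natCard_le_of_imp fun j hj => ⟨hj.1, hj.2.1, hj.2.2⟩

/-- A site dilated past `t ≥ (122/125)(51/50)` is a `64`-deeply registered LONG scale-bad site at `a = 122/125`, margin `0` ((413) `dilated_regScaleBad`
with the literal freed). [this node] -/
theorem dilatedT_regScaleBad {δ t : ℝ} (ht : 122 / 125 * (51 / 50 : ℝ) ≤ t) {y : Fin N → EuclideanSpace ℝ (Fin 3)} {j : Fin N}
    (h : DilatedT δ t y j) :
    (Bad (122 / 125) 0 y j ∧ (Short (122 / 125) 0 y j ∨ Long (122 / 125) 0 y j)) ∧ DeepReg 64 (3 / 50) (1 / 450) y j := by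
  have hReg : Reg (3 / 50) (1 / 450) y j := h.1 j (by rw [dist_self]; exact mul_nonneg (by norm_num) (nearestDist_nonneg y j))
  have hcf : IsChargeFree (1 / 100 : ℝ) y j := hReg.1
  have ht' : (122 / 125 : ℝ) * (1 + 1 / 50) + 0 ≤ t := by norm_num at ht ⊢; exact ht
  have hfar : ∀ k : Fin N, k ≠ j → (122 / 125 : ℝ) * (1 + 1 / 50) + 0 < dist (y j) (y k) := fun k hk => by
    have h1 := nearestDist_le_dist y hk
    have h2 := h.2.2
    linarith
  refine ⟨⟨⟨hcf, fun hRT => ?_⟩, Or.inr ?_⟩, h.1⟩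
  · obtain ⟨_, h12, _⟩ := hRT
    have hS : {w ∈ Set.range y | w ≠ y j ∧ dist (y j) w ≤ 122 / 125 * (1 + 1 / 50) + 0} = ∅ := by
      refine Set.subset_empty_iff.1 fun w hw => ?_
      obtain ⟨⟨k, rfl⟩, hne, hd⟩ := hw
      have hkj : k ≠ j := fun hkj => hne (by rw [hkj])
      exact absurd hd (not_le.2 (hfar k hkj))
    rw [hS, Set.ncard_empty] at h12
    omega
  · have hne : ((bondGraph (1 / 100 : ℝ) y).neighborSet j).Nonempty :=
      Set.nonempty_of_ncard_ne_zero (by rw [hcf.1]; norm_num)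
    obtain ⟨k, hk⟩ := hne
    rw [SimpleGraph.mem_neighborSet] at hk
    exact ⟨k, hk, hfar k hk.ne.symm⟩

/-- `#DilatedT δ t ≤ regScaleCount (122/125) 0 64 (3/50) (1/450)` for `t ≥ (122/125)(51/50)`. [this node] -/
theorem dilatedTCount_le_regScaleCount {t : ℝ} (ht : 122 / 125 * (51 / 50 : ℝ) ≤ t) (δ : ℝ) (y : Fin N → EuclideanSpace ℝ (Fin 3)) :
    dilatedTCount δ t y ≤ regScaleCount (122 / 125) 0 64 (3 / 50) (1 / 450) y := by
  unfold dilatedTCount regScaleCount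
  exact natCard_le_of_imp fun j hj => dilatedT_regScaleBad ht hj

/-- **`DilatedDeepT t ⟸ TBDSG(ρ)`**, any `ρ ≤ 64`, any `t ≥ (122/125)(51/50) = 0.99552` (so for the record `t = 1`): no new strength. [this node] -/
theorem dilatedDeepT_of_tbdsg {ρ t : ℝ} (hρ : ρ ≤ 64) (ht : 122 / 125 * (51 / 50 : ℝ) ≤ t)
    (h : TameBalancedDeepScaleGap (122 / 125) 0 ρ (3 / 50) (1 / 450)) : DilatedDeepT t := by
  intro δ hδ hδ2
  have h64 : CensusW (fun y => regScaleCount (122 / 125) 0 64 (3 / 50) (1 / 450) y) (fun y => notDeepCount 64 (3 / 50) (1 / 450) y) δ 2 :=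
    tameBalancedDeepScaleGap_mono hρ h δ hδ hδ2
  exact censusW_mono (fun y => dilatedTCount_le_regScaleCount ht δ y) (fun _ => le_rfl) h64

/-! ## §5  The pointwise normal form with a guard (PROVED) -/

/-- A `(L + 128/δ)`-deep in-window CALM site whose ball is NOT `G`-guarded sees within `2L` an in-window `64`-deep guard-bad site. [this node] -/
theorem exists_guardBad_of_calm {G : ∀ {N : ℕ}, (Fin N → EuclideanSpace ℝ (Fin 3)) → Fin N → Prop} {δ τ L : ℝ} (hδ : 0 < δ) (hL : 0 ≤ L)
    {y : Fin N → EuclideanSpace ℝ (Fin 3)} {i : Fin N} (hw : InWindow δ 2 y i) (hD : DeepReg (L + 128 / δ) (3 / 50) (1 / 450) y i)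
    (hc : Calm δ τ L y i) (hg : ¬ BallGuard G L y i) :
    ∃ j : Fin N, (InWindow δ 2 y j ∧ DeepReg 64 (3 / 50) (1 / 450) y j ∧ ¬ G y j) ∧ dist (y i) (y j) ≤ 2 * L := by
  have key : ∃ j : Fin N, dist (y j) (y i) ≤ L * nearestDist y i ∧ ¬ G y j := by
    by_contra hne
    exact hg fun i' hi' => by
      by_contra hx
      exact hne ⟨i', hi', hx⟩
  obtain ⟨j, hj, hjG⟩ := key
  have hwj : InWindow δ 2 y j := (hc.2 j hj).1
  refine ⟨j, ⟨hwj, ?_, hjG⟩, ?_⟩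
  · intro k hk
    apply hD k
    have hnj : nearestDist y j ≤ 2 := hwj.2
    have hni : δ ≤ nearestDist y i := hw.1
    have h1 : 64 * nearestDist y j ≤ 128 := by linarith
    have h2 : (128 : ℝ) ≤ 128 / δ * nearestDist y i := by
      rw [div_mul_eq_mul_div, le_div_iff₀ hδ]
      nlinarith
    calc dist (y k) (y i) ≤ dist (y k) (y j) + dist (y j) (y i) := dist_triangle _ _ _
      _ ≤ 64 * nearestDist y j + L * nearestDist y i := add_le_add hk hj
      _ ≤ (L + 128 / δ) * nearestDist y i := by nlinarith
  · calc dist (y i) (y j) = dist (y j) (y i) := dist_comm _ _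
      _ ≤ L * nearestDist y i := hj
      _ ≤ L * 2 := mul_le_mul_of_nonneg_left hw.2 hL
      _ = 2 * L := by ring

/-- A guarded-calm MID site (calm depth `L ≥ 12 + 128/δ`) sees within `12·nn ≤ 24` a loose or an optic calm site of depth `R`, homogeneous on its whole
`R`-ball — provided GUARDED rigidity holds at calm depth `L₀` and `R + 2L₀/δ ≤ (L − 12)δ/2` ((413) `exists_loose_or_optic_of_calm_mid`, rigidity asked
only of guarded balls). [this node] -/
theorem exists_loose_or_optic_of_calmG_mid {G : ∀ {N : ℕ}, (Fin N → EuclideanSpace ℝ (Fin 3)) → Fin N → Prop} {δ τ L L₀ R η₂ : ℝ}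
    (hδ : 0 < δ) (hL₀ : 0 ≤ L₀) (hR : 0 ≤ R) (hL : 12 + 128 / δ ≤ L) (hLR : R + 2 * L₀ / δ ≤ (L - 12) * δ / 2)
    {y : Fin N → EuclideanSpace ℝ (Fin 3)} (hrig : ∀ i' : Fin N, CalmG G δ τ L₀ y i' → OptDeepReg 12 η₂ (1 / 10) (1 / 450) y i')
    {i : Fin N} (hc : CalmG G δ τ L y i) (hM : ¬ AffDeepReg 12 (1 / 10 ^ 4) (1 / 25) (1 / 450) y i) :
    ∃ j : Fin N, (LooseCalmSite δ η₂ τ R y j ∨ OpticCalmSite δ η₂ τ R y j) ∧ dist (y i) (y j) ≤ 24 := by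
  have h128 : 0 ≤ 128 / δ := div_nonneg (by norm_num) hδ.le
  have hL12 : 12 ≤ L := by linarith
  have hA0 : 0 ≤ 2 * L₀ / δ := div_nonneg (by linarith) hδ.le
  have hRL' : R ≤ (L - 12) * δ / 2 := by linarith
  have key : ∃ j : Fin N, dist (y j) (y i) ≤ 12 * nearestDist y i ∧ ¬ AffReg (1 / 10 ^ 4) (1 / 25) (1 / 450) y j := by
    by_contra hne
    exact hM fun i' hi' => by
      by_contra hx
      exact hne ⟨i', hi', hx⟩
  obtain ⟨j, hj, hjA⟩ := key
  have hwi : InWindow δ 2 y i := (hc.1.2 i (by rw [dist_self]; exact mul_nonneg (by linarith) (nearestDist_nonneg y i))).1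
  have hwj : InWindow δ 2 y j := (hc.1.2 j (hj.trans (mul_le_mul_of_nonneg_right hL12 (nearestDist_nonneg y i)))).1
  have hcj' : CalmG G δ τ ((L - 12) * δ / 2) y j := calmG_of_near hδ (by norm_num) hL12 hc hj
  have hcj : CalmG G δ τ R y j := calmG_anti le_rfl hRL' hcj'
  have hOj : OptDeepReg R η₂ (1 / 10) (1 / 450) y j := by
    intro i' hi'
    have hci' : CalmG G δ τ (((L - 12) * δ / 2 - R) * δ / 2) y i' := calmG_of_near hδ hR hRL' hcj' hi'
    have hdepth : L₀ ≤ ((L - 12) * δ / 2 - R) * δ / 2 := by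
      have h1 : 2 * L₀ / δ ≤ (L - 12) * δ / 2 - R := by linarith
      have h2 : 2 * L₀ / δ * δ = 2 * L₀ := div_mul_cancel₀ _ hδ.ne'
      nlinarith
    exact optReg_of_optDeepReg (by norm_num) (hrig i' (calmG_anti le_rfl hdepth hci'))
  have hDj : DeepReg 64 (3 / 50) (1 / 450) y j := by
    intro k hk
    apply hc.1.1 k
    have hnj : nearestDist y j ≤ 2 := hwj.2
    have hni : δ ≤ nearestDist y i := hwi.1
    have h1 : 64 * nearestDist y j ≤ 128 := by linarith
    have h2 : (128 : ℝ) ≤ 128 / δ * nearestDist y i := by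
      rw [div_mul_eq_mul_div, le_div_iff₀ hδ]
      nlinarith
    have h3 : (12 + 128 / δ) * nearestDist y i ≤ L * nearestDist y i := mul_le_mul_of_nonneg_right hL (nearestDist_nonneg y i)
    calc dist (y k) (y i) ≤ dist (y k) (y j) + dist (y j) (y i) := dist_triangle _ _ _
      _ ≤ 64 * nearestDist y j + 12 * nearestDist y i := add_le_add hk hj
      _ ≤ (12 + 128 / δ) * nearestDist y i := by nlinarith
      _ ≤ L * nearestDist y i := h3
  refine ⟨j, ?_, ?_⟩
  · by_cases hA : AffReg (1 / 10 ^ 4) (1 / 10) (1 / 450) y j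
    · exact Or.inl ⟨hDj, hcj.1, hOj, hA, hjA⟩
    · exact Or.inr ⟨hDj, hcj.1, hOj, hA⟩
  · calc dist (y i) (y j) = dist (y j) (y i) := dist_comm _ _
      _ ≤ 12 * nearestDist y i := hj
      _ ≤ 12 * 2 := mul_le_mul_of_nonneg_left hwi.2 (by norm_num)
      _ = 24 := by norm_num

end Summit.AtomisticToContinuum.Crystallization.Theorems.OverbindingBudgetAffineStableDescent
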